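import Mathlib.Geometry.Manifold.Instances.Sphere
import Mathlib.Analysis.SpecialFunctions.Complex.Circle
import Mathlib.Analysis.SpecialFunctions.Complex.LogDeriv
import Mathlib.Analysis.SpecialFunctions.Trigonometric.Deriv
import Literature.Topology.FourManifolds.CircleSurgery
import Literature.Topology.FourManifolds.Knots
import HarnessLib

/-!
# Exponential coordinates on the 3-torus and angle coordinates on the circle `𝕊¹ ⊆ ℝ²`

Elementary coordinate charts used in the Cappell–Shaneson construction (the section circle of the
mapping torus of `A ∈ SL(3, ℤ)` and its tubular neighbourhood, forthcoming module
`Literature.Topology.FourManifolds.SectionCircleNbhd`):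

* `Literature.expT : ℝ³ → T³`, `v ↦ (e^{i v₀}, e^{i v₁}, e^{i v₂})`, its local inverse `Literature.Topology.FourManifolds.logT` (principal
  arguments), smoothness of both, `logT (expT v) = v` on `(-π, π]³`, and the equivariance
  `torusMap A (expT v) = expT (A v)` (`Literature.Topology.FourManifolds.torusMap_expT`): the linear diffeomorphism of the torus
  defined by `A ∈ SL(3, ℤ)` is covered by the linear map `A`. (Here `T³ = ℝ³/2πℤ³` since `expT`
  has period `2π` in each coordinate; Cappell–Shaneson, *Some new four-manifolds*, Ann. of Math.
  104 (1976), §2, write `ℝ³/ℤ³` — the two conventions differ by the scaling `2π`, which commutes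
  with `A`.) Matrices act on `EuclideanSpace ℝ (Fin 3)` through Mathlib's `Matrix.toEuclideanLin`,
  abbreviated `Literature.Topology.FourManifolds.mulVecE`.
* `Literature.circlePt : ℝ → 𝕊¹`, `θ ↦ (cos 2πθ, sin 2πθ)` (the unit-period reparametrisation
  `circlePoint (2πθ)` of the tree's `Literature.Topology.FourManifolds.circlePoint`, `Literature.Topology.FourManifolds.Knots`)
  and the two angle functions
  `Literature.angA : 𝕊¹ → (0, 1]`, `Literature.angB : 𝕊¹ → (1/2, 3/2]` inverting it away from `(1, 0)` resp.
  `(-1, 0)`, with their smoothness (via `Complex.arg` on the slit plane) and the transition rule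
  `angB = angA + 1` on the upper, `angB = angA` on the lower half circle (`Literature.Topology.FourManifolds.angB_eq_of_ne`).

Everything here is folklore calculus; the only inputs are Mathlib's `Circle.exp`/`Complex.arg` API and
the manifold structure of spheres (the `Fact (finrank ℝ ℝ² = 1 + 1)` needed by Mathlib's sphere
lemmas is supplied inline, as in `Mathlib/Geometry/Manifold/Instances/Sphere.lean`).
-/

open scoped Manifold ContDiff Topology Real
open Set Function Metric Complex
open scoped Matrix

noncomputable section

namespace Literature.Topology.FourManifolds

/-- Local notation: `𝔼 n` is the model Euclidean space `EuclideanSpace ℝ (Fin n)`. -/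
local notation "𝔼 " n:arg => EuclideanSpace ℝ (Fin n)

/-- Local notation: `𝕊 n` is the unit sphere in `EuclideanSpace ℝ (Fin (n + 1))`. -/
local notation "𝕊 " n:arg => (Metric.sphere (0 : EuclideanSpace ℝ (Fin (n + 1))) 1)

/-- Local notation: the model with corners `𝓣 = (𝓡 1).prod ((𝓡 1).prod (𝓡 1))` of `ThreeTorus`. -/
local notation "𝓣" =>
  (ModelWithCorners.prod (𝓡 1) (ModelWithCorners.prod (𝓡 1) (𝓡 1)))

attribute [local instance] finrank_real_complex_fact'

/-! ### Real smoothness of the argument on the slit plane -/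

/-- The principal argument is real-`C^∞` on the slit plane (it is the imaginary part of the
holomorphic logarithm). [folklore] -/
theorem contDiffAt_arg {z : ℂ} (hz : z ∈ slitPlane) : ContDiffAt ℝ ∞ arg z := by
  have h : ContDiffAt ℝ ∞ (fun w ↦ (log w).im) z :=
    imCLM.contDiff.contDiffAt.comp z ((contDiffAt_log hz).restrict_scalars ℝ)
  exact h.congr_of_eventuallyEq (Filter.Eventually.of_forall fun w ↦ (log_im w).symm)

/-- A complex number of norm one lies in the slit plane iff it is not `-1`. [folklore] -/
theorem mem_slitPlane_of_norm_eq_one {z : ℂ} (hz : ‖z‖ = 1) (h : z ≠ -1) : z ∈ slitPlane := by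
  rw [mem_slitPlane_iff_arg]
  refine ⟨fun hπ ↦ h ?_, fun h0 ↦ by simp [h0] at hz⟩
  have := norm_mul_exp_arg_mul_I z
  rw [hπ, hz, exp_pi_mul_I] at this
  simpa using this.symm

/-! ### Matrices acting on `ℝ³ = EuclideanSpace ℝ (Fin 3)` -/

section MulVec

variable {m : ℕ}

/-- The action of a real `m × m` matrix on `EuclideanSpace ℝ (Fin m)`: a short name for Mathlib's
`Matrix.toEuclideanLin M v = toLp 2 (M *ᵥ ofLp v)` (`mulVecE_eq_toEuclideanLin` is `rfl`). It is a
definition marked `@[irreducible]` rather than an `abbrev`: the tube formulas downstream iterate it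
pointwise inside `expT`, and keeping the linear-equivalence coercions of `toEuclideanLin` sealed
keeps their elaboration cheap (unifying through the unfolded `LinearEquiv` application times out);
all algebraic facts are Mathlib's, transported along the bridge `mulVecE_eq_toEuclideanLin`. [folklore] -/
@[irreducible] def mulVecE (M : Matrix (Fin m) (Fin m) ℝ) (v : 𝔼 m) : 𝔼 m := Matrix.toEuclideanLin M v

/-- `mulVecE` is Mathlib's `Matrix.toEuclideanLin` (the definition, unsealed). [folklore] -/
theorem mulVecE_eq_toEuclideanLin (M : Matrix (Fin m) (Fin m) ℝ) (v : 𝔼 m) :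
    mulVecE M v = Matrix.toEuclideanLin M v := by
  unfold mulVecE; rfl

/-- Coordinates of `mulVecE M v` (Mathlib `Matrix.toLpLin_apply`, `Matrix.mulVec`). [folklore] -/
theorem mulVecE_apply (M : Matrix (Fin m) (Fin m) ℝ) (v : 𝔼 m) (i : Fin m) :
    mulVecE M v i = ∑ j, M i j * v j := by
  rw [mulVecE_eq_toEuclideanLin]; rfl

/-- `mulVecE` is compatible with matrix multiplication (Mathlib `Matrix.mulVec_mulVec`). [folklore] -/
theorem mulVecE_mulVecE (M N : Matrix (Fin m) (Fin m) ℝ) (v : 𝔼 m) :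
    mulVecE M (mulVecE N v) = mulVecE (M * N) v := by
  simp [mulVecE_eq_toEuclideanLin, Matrix.toLpLin_apply, Matrix.mulVec_mulVec]

/-- The identity matrix acts trivially (Mathlib `Matrix.one_mulVec`). [folklore] -/
@[simp] theorem mulVecE_one (v : 𝔼 m) : mulVecE 1 v = v := by
  simp [mulVecE_eq_toEuclideanLin]

/-- Matrices act linearly: zero goes to zero (Mathlib `map_zero`). [folklore] -/
@[simp] theorem mulVecE_zero (M : Matrix (Fin m) (Fin m) ℝ) : mulVecE M 0 = 0 := by
  rw [mulVecE_eq_toEuclideanLin, map_zero]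

/-- **Coordinate bound**: if all entries of `M` are bounded by `K`, each coordinate of `M v` is
bounded by `m K ‖v‖`. [folklore] -/
theorem abs_mulVecE_apply_le {M : Matrix (Fin m) (Fin m) ℝ} {K : ℝ} (hK : ∀ i j, |M i j| ≤ K)
    (v : 𝔼 m) (i : Fin m) : |mulVecE M v i| ≤ m * K * ‖v‖ := by
  rw [mulVecE_apply]
  calc |∑ j, M i j * v j| ≤ ∑ j, |M i j * v j| := Finset.abs_sum_le_sum_abs _ _
    _ ≤ ∑ _j : Fin m, K * ‖v‖ := Finset.sum_le_sum fun j _ ↦ by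
        rw [abs_mul]
        exact mul_le_mul (hK i j) (by simpa using PiLp.norm_apply_le v j) (abs_nonneg _)
          ((abs_nonneg _).trans (hK i j))
    _ = m * K * ‖v‖ := by simp [mul_assoc]

/-- Joint smoothness of `(θ, v) ↦ M(θ) v` for an entrywise smooth matrix-valued map `M`. [folklore] -/
theorem contDiff_mulVecE {M : ℝ → Matrix (Fin m) (Fin m) ℝ} (hM : ∀ i j, ContDiff ℝ ∞ fun θ ↦ M θ i j) :
    ContDiff ℝ ∞ fun p : ℝ × 𝔼 m ↦ mulVecE (M p.1) p.2 := by
  rw [contDiff_euclidean]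
  intro i
  simp only [mulVecE_apply]
  exact ContDiff.sum fun j _ ↦ ((hM i j).comp contDiff_fst).mul
    ((contDiff_piLp_apply (p := 2) (i := j)).comp contDiff_snd)

end MulVec

/-! ### Exponential coordinates on the 3-torus -/

section Torus

/-- **Exponential coordinates on `T³`**: `expT v = (e^{i v₀}, e^{i v₁}, e^{i v₂})`, the universal
covering `ℝ³ → ℝ³ / 2πℤ³ = T³` (Cappell–Shaneson 1976, §2). [folklore] -/
def expT (v : 𝔼 3) : ThreeTorus := (Circle.exp (v 0), Circle.exp (v 1), Circle.exp (v 2))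

/-- The coordinates of `expT v` are the `e^{i vⱼ}`. [folklore] -/
@[simp] theorem torusCoord_expT (v : 𝔼 3) (j : Fin 3) : torusCoord (expT v) j = Circle.exp (v j) := by
  fin_cases j <;> rfl

/-- `expT 0 = 1`. [folklore] -/
@[simp] theorem expT_zero : expT 0 = 1 := by
  apply torusCoord_injective; ext j : 1; simp

/-- `expT` is smooth. [folklore] -/
theorem contMDiff_expT : ContMDiff 𝓘(ℝ, 𝔼 3) 𝓣 ∞ expT := by
  have h : ∀ j : Fin 3, ContMDiff 𝓘(ℝ, 𝔼 3) (𝓡 1) ∞ fun v : 𝔼 3 ↦ Circle.exp (v j) := fun j ↦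
    contMDiff_circleExp.comp (EuclideanSpace.proj (𝕜 := ℝ) j).contMDiff
  exact (h 0).prodMk ((h 1).prodMk (h 2))

/-- `expT` is continuous. [folklore] -/
theorem continuous_expT : Continuous expT := contMDiff_expT.continuous

/-- Integer powers of `e^{it}` on the circle. [folklore] -/
theorem circleExp_zpow (t : ℝ) (k : ℤ) : Circle.exp t ^ k = Circle.exp (k * t) := by
  rw [← Circle.exp_zsmul, zsmul_eq_mul]

/-- **Equivariance of the exponential coordinates**: the monomial map `torusMap A` of an integer
matrix is covered by the linear map `A` on `ℝ³`, `torusMap A (expT v) = expT (A v)`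
(Cappell–Shaneson 1976, §2: `A ∈ SL(3, ℤ)` acts on `T³ = ℝ³/ℤ³`). [folklore] -/
theorem torusMap_expT (A : Matrix (Fin 3) (Fin 3) ℤ) (v : 𝔼 3) :
    torusMap A (expT v) = expT (mulVecE (A.map (Int.cast : ℤ → ℝ)) v) := by
  apply torusCoord_injective
  ext i : 1
  rw [torusCoord_torusMap, torusCoord_expT, mulVecE_apply, torusMonomial]
  simp only [torusCoord_expT, circleExp_zpow, Fin.prod_univ_three, Fin.sum_univ_three,
    Matrix.map_apply, ← Circle.exp_add]

/-- **Logarithmic coordinates**: the principal arguments of the three circle coordinates,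
`logT z ∈ (-π, π]³`. [folklore] -/
def logT (z : ThreeTorus) : 𝔼 3 := WithLp.toLp 2 fun j ↦ arg (torusCoord z j : ℂ)

/-- Coordinates of `logT`. [folklore] -/
@[simp] theorem logT_apply (z : ThreeTorus) (j : Fin 3) : logT z j = arg (torusCoord z j : ℂ) := rfl

/-- `expT ∘ logT = id`. [folklore] -/
@[simp] theorem expT_logT (z : ThreeTorus) : expT (logT z) = z := by
  apply torusCoord_injective; ext j : 1
  rw [torusCoord_expT, logT_apply, Circle.exp_arg]

/-- `logT ∘ expT = id` on `(-π, π]³`. [folklore] -/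
theorem logT_expT {v : 𝔼 3} (hv : ∀ j, v j ∈ Ioc (-π) π) : logT (expT v) = v := by
  ext j
  rw [logT_apply, torusCoord_expT, Circle.arg_exp (hv j).1 (hv j).2]

/-- `expT` is injective on `(-π, π]³`. [folklore] -/
theorem expT_injOn : InjOn expT {v : 𝔼 3 | ∀ j, v j ∈ Ioc (-π) π} := fun v hv w hw h ↦ by
  rw [← logT_expT hv, ← logT_expT hw, h]

/-- The coordinates of `logT` lie in `(-π, π]`. [folklore] -/
theorem logT_apply_mem (z : ThreeTorus) (j : Fin 3) : logT z j ∈ Ioc (-π) π :=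
  ⟨neg_pi_lt_arg _, arg_le_pi _⟩

/-- The open subset of `T³` where no coordinate equals `-1`: the domain where `logT` is smooth. [folklore] -/
def torusSlit : Set ThreeTorus := {z | ∀ j, (torusCoord z j : ℂ) ∈ slitPlane}

/-- Each complex coordinate `T³ → ℂ` is smooth. [folklore] -/
theorem contMDiff_coe_torusCoord (j : Fin 3) :
    ContMDiff 𝓣 𝓘(ℝ, ℂ) ∞ fun z : ThreeTorus ↦ (torusCoord z j : ℂ) := by
  have h : ContMDiff (𝓡 1) 𝓘(ℝ, ℂ) ∞ (fun z : Circle ↦ (z : ℂ)) := contMDiff_coe_sphere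
  exact h.comp (contMDiff_torusCoord j)

/-- `torusSlit` is open. [folklore] -/
theorem isOpen_torusSlit : IsOpen torusSlit := by
  have : torusSlit = ⋂ j, (fun z : ThreeTorus ↦ (torusCoord z j : ℂ)) ⁻¹' slitPlane := by
    ext z; simp [torusSlit]
  rw [this]
  exact isOpen_iInter_of_finite fun j ↦
    isOpen_slitPlane.preimage (contMDiff_coe_torusCoord j).continuous

/-- **`logT` is smooth on `torusSlit`.** [folklore] -/
theorem contMDiffOn_logT : ContMDiffOn 𝓣 𝓘(ℝ, 𝔼 3) ∞ logT torusSlit := by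
  have h : ContMDiffOn 𝓣 𝓘(ℝ, Fin 3 → ℝ) ∞ (fun z j ↦ arg (torusCoord z j : ℂ)) torusSlit := by
    rw [contMDiffOn_pi_space]
    intro j z hz
    exact ((contDiffAt_arg (hz j)).comp_contMDiffAt (f := fun z : ThreeTorus ↦ (torusCoord z j : ℂ))
      (contMDiff_coe_torusCoord j).contMDiffAt).contMDiffWithinAt
  have hE : ContMDiff 𝓘(ℝ, Fin 3 → ℝ) 𝓘(ℝ, 𝔼 3) ∞
      ((EuclideanSpace.equiv (Fin 3) ℝ).symm : (Fin 3 → ℝ) →L[ℝ] 𝔼 3) :=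
    ContinuousLinearMap.contMDiff _
  exact (hE.comp_contMDiffOn h).congr fun z _ ↦ rfl

/-- A vector with all coordinates in `(-π, π)` exponentiates into `torusSlit`. [folklore] -/
theorem expT_mem_torusSlit {v : 𝔼 3} (hv : ∀ j, |v j| < π) : expT v ∈ torusSlit := by
  intro j
  rw [torusCoord_expT, mem_slitPlane_iff_arg,
    Circle.arg_exp (abs_lt.1 (hv j)).1 (abs_lt.1 (hv j)).2.le]
  exact ⟨(abs_lt.1 (hv j)).2.ne, Circle.coe_ne_zero _⟩

/-- On vectors with coordinates in `(-π, π)`, `logT` inverts `expT`. [folklore] -/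
theorem logT_expT_of_abs_lt {v : 𝔼 3} (hv : ∀ j, |v j| < π) : logT (expT v) = v :=
  logT_expT fun j ↦ ⟨(abs_lt.1 (hv j)).1, (abs_lt.1 (hv j)).2.le⟩

end Torus

/-! ### Angle coordinates on the circle `𝕊¹ ⊆ ℝ²` -/

section CircleAngle

/-- The identification `ℝ² → ℂ`, `v ↦ v₀ + i v₁`. This is Mathlib's isometry
`Complex.orthonormalBasisOneI.repr.symm : EuclideanSpace ℝ (Fin 2) ≃ₗᵢ[ℝ] ℂ`
(`toC_eq_orthonormalBasisOneI_repr_symm`), kept as a plain function with definitional real and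
imaginary parts for the pointwise angle computations below; its restriction to `𝕊¹` is the tree's
`Literature.Topology.FourManifolds.circleToComplex` (`Literature.Topology.FourManifolds.KnotGroup`, not imported here). [folklore] -/
def toC (v : 𝔼 2) : ℂ := ⟨v 0, v 1⟩

/-- `toC` is the inverse of Mathlib's orthonormal basis isomorphism `ℂ ≃ ℝ²` for the basis
`(1, i)`. [folklore] -/
theorem toC_eq_orthonormalBasisOneI_repr_symm (v : 𝔼 2) :
    toC v = Complex.orthonormalBasisOneI.repr.symm v := by
  rw [Complex.orthonormalBasisOneI_repr_symm_apply]
  apply Complex.ext <;> simp [toC]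

/-- The real part of `toC v` is `v₀`. [folklore] -/
@[simp] theorem toC_re (v : 𝔼 2) : (toC v).re = v 0 := rfl
/-- The imaginary part of `toC v` is `v₁`. [folklore] -/
@[simp] theorem toC_im (v : 𝔼 2) : (toC v).im = v 1 := rfl

/-- `toC` is smooth (it is real linear). [folklore] -/
theorem contDiff_toC : ContDiff ℝ ∞ toC := by
  have : toC = fun v ↦ equivRealProdCLM.symm (v 0, v 1) := by
    funext v; apply Complex.ext <;> simp [toC]
  rw [this]
  exact equivRealProdCLM.symm.contDiff.comp
    ((contDiff_piLp_apply (p := 2) (i := (0 : Fin 2))).prodMk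
      (contDiff_piLp_apply (p := 2) (i := (1 : Fin 2))))

/-- `toC` is injective. [folklore] -/
theorem toC_injective : Injective toC := by
  intro v w h
  ext i
  fin_cases i
  · exact congrArg re h
  · exact congrArg im h

/-- `toC` preserves the norm. [folklore] -/
theorem norm_toC (v : 𝔼 2) : ‖toC v‖ = ‖v‖ := by
  rw [Complex.norm_def, normSq_apply, EuclideanSpace.norm_eq, Fin.sum_univ_two, toC_re, toC_im]
  simp [sq]

/-- A point of the unit circle `𝕊¹ ⊆ ℝ²` gives a unit complex number. [folklore] -/
theorem norm_toC_sphere (u : 𝕊 1) : ‖toC (u : 𝔼 2)‖ = 1 := by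
  rw [norm_toC]; exact norm_eq_of_mem_sphere u

/-- `toC u ≠ 0` for `u ∈ 𝕊¹`. [folklore] -/
theorem toC_sphere_ne_zero (u : 𝕊 1) : toC (u : 𝔼 2) ≠ 0 := by
  rw [← norm_pos_iff, norm_toC_sphere]; exact one_pos

/-- The unit complex number of a point of `𝕊¹ ⊆ ℝ²`, as an element of `Circle`. [folklore] -/
def toCircle (u : 𝕊 1) : Circle := ⟨toC (u : 𝔼 2), mem_sphere_zero_iff_norm.2 (norm_toC_sphere u)⟩

/-- The complex number underlying `toCircle u` is `toC u`. [folklore] -/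
@[simp] theorem coe_toCircle (u : 𝕊 1) : (toCircle u : ℂ) = toC (u : 𝔼 2) := rfl

/-- `toCircle : 𝕊¹ → Circle` is injective. [folklore] -/
theorem toCircle_injective : Injective toCircle := fun _ _ h ↦
  Subtype.ext (toC_injective (congrArg Subtype.val h :))

/-- **The unit-period parametrisation of the circle** `θ ↦ (cos 2πθ, sin 2πθ) ∈ 𝕊¹`, i.e.
`circlePoint (2πθ)` for the tree's `Literature.Topology.FourManifolds.circlePoint` (`Literature.Topology.FourManifolds.Knots`).
It gets its own name because the mapping torus pieces are the unit-length intervals `(0, 1)`,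
`(1/2, 3/2)`, on which `circlePt` is inverted by the angle functions `angA`, `angB` below. [folklore] -/
def circlePt (θ : ℝ) : 𝕊 1 := circlePoint (2 * π * θ)

/-- `circlePt θ = circlePoint (2πθ)` (by definition). [folklore] -/
theorem circlePt_eq_circlePoint (θ : ℝ) : circlePt θ = circlePoint (2 * π * θ) := rfl

/-- First coordinate of `circlePt θ` is `cos 2πθ`. [folklore] -/
@[simp] theorem circlePt_apply_zero (θ : ℝ) : (circlePt θ : 𝔼 2) 0 = Real.cos (2 * π * θ) := rfl

/-- Second coordinate of `circlePt θ` is `sin 2πθ`. [folklore] -/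
@[simp] theorem circlePt_apply_one (θ : ℝ) : (circlePt θ : 𝔼 2) 1 = Real.sin (2 * π * θ) := rfl

/-- `toC (circlePt θ) = e^{2πiθ}`. [folklore] -/
theorem toC_circlePt (θ : ℝ) : toC (circlePt θ : 𝔼 2) = Circle.exp (2 * π * θ) := by
  apply Complex.ext
  · rw [toC_re, circlePt_apply_zero, Circle.coe_exp, exp_ofReal_mul_I_re]
  · rw [toC_im, circlePt_apply_one, Circle.coe_exp, exp_ofReal_mul_I_im]

/-- `toCircle (circlePt θ) = e^{2πiθ}`. [folklore] -/
@[simp] theorem toCircle_circlePt (θ : ℝ) : toCircle (circlePt θ) = Circle.exp (2 * π * θ) :=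
  Circle.ext (toC_circlePt θ)

/-- `circlePt` is smooth (from `contDiff_coe_circlePoint`). [folklore] -/
theorem contMDiff_circlePt : ContMDiff 𝓘(ℝ, ℝ) (𝓡 1) ∞ circlePt :=
  haveI := Fact.mk (@finrank_euclideanSpace_fin ℝ _ 2)
  (contDiff_coe_circlePoint.comp (contDiff_const.mul contDiff_id)).contMDiff.codRestrict_sphere
    fun θ ↦ (circlePt θ).2

/-- `circlePt` is continuous. [folklore] -/
theorem continuous_circlePt : Continuous circlePt := contMDiff_circlePt.continuous

/-- `circlePt` has period `1`. [folklore] -/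
theorem circlePt_add_one (θ : ℝ) : circlePt (θ + 1) = circlePt θ := by
  apply toCircle_injective
  rw [toCircle_circlePt, toCircle_circlePt, mul_add, mul_one, Circle.exp_add, Circle.exp_two_pi,
    mul_one]

/-- The base point `(1, 0) = circlePt 0` of `𝕊¹` (excluded from the first angle chart). [folklore] -/
def ptA : 𝕊 1 := circlePt 0

/-- The antipode `(-1, 0) = circlePt (1/2)` (excluded from the second angle chart). [folklore] -/
def ptB : 𝕊 1 := circlePt (1 / 2)

/-- `ptA` corresponds to `1 ∈ 𝕊¹ ⊆ ℂ`. [folklore] -/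
@[simp] theorem toCircle_ptA : toCircle ptA = 1 := by simp [ptA]

/-- `toC ptA = 1`. [folklore] -/
theorem toC_ptA : toC (ptA : 𝔼 2) = 1 := congrArg Subtype.val toCircle_ptA

/-- `ptB` corresponds to `-1 ∈ 𝕊¹ ⊆ ℂ`. [folklore] -/
@[simp] theorem coe_toCircle_ptB : (toCircle ptB : ℂ) = -1 := by
  rw [ptB, toCircle_circlePt, Circle.coe_exp]
  have : ((2 * π * (1 / 2) : ℝ) : ℂ) = π := by push_cast; ring
  rw [this, exp_pi_mul_I]

/-- `toC ptB = -1`. [folklore] -/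
theorem toC_ptB : toC (ptB : 𝔼 2) = -1 := coe_toCircle_ptB

/-- `u = ptA` iff `toC u = 1`. [folklore] -/
theorem eq_ptA_iff (u : 𝕊 1) : u = ptA ↔ toC (u : 𝔼 2) = 1 := by
  rw [← toC_ptA]
  exact ⟨fun h ↦ h ▸ rfl, fun h ↦ Subtype.ext (toC_injective h)⟩

/-- `u = ptB` iff `toC u = -1`. [folklore] -/
theorem eq_ptB_iff (u : 𝕊 1) : u = ptB ↔ toC (u : 𝔼 2) = -1 := by
  rw [← toC_ptB]
  exact ⟨fun h ↦ h ▸ rfl, fun h ↦ Subtype.ext (toC_injective h)⟩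

/-- **First angle function** `angA : 𝕊¹ → (0, 1]`, `angA u = 1/2 + arg(-u)/2π`; it inverts
`circlePt` on `(0, 1)` and is smooth away from `ptA = (1, 0)`. [folklore] -/
def angA (u : 𝕊 1) : ℝ := 1 / 2 + arg (-toC (u : 𝔼 2)) / (2 * π)

/-- **Second angle function** `angB : 𝕊¹ → (1/2, 3/2]`, `angB u = 1 + arg(u)/2π`; it inverts
`circlePt` on `(1/2, 3/2)` and is smooth away from `ptB = (-1, 0)`. [folklore] -/
def angB (u : 𝕊 1) : ℝ := 1 + arg (toC (u : 𝔼 2)) / (2 * π)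

/-- A unit complex number with vanishing imaginary part is `±1`. [folklore] -/
theorem toC_eq_or_of_im_eq_zero (u : 𝕊 1) (h : (toC (u : 𝔼 2)).im = 0) :
    toC (u : 𝔼 2) = 1 ∨ toC (u : 𝔼 2) = -1 := by
  have hn := norm_toC_sphere u
  rw [Complex.norm_def, normSq_apply, h, mul_zero, add_zero, Real.sqrt_mul_self_eq_abs] at hn
  rcases (abs_eq zero_le_one).1 hn with hre | hre
  · exact Or.inl (Complex.ext_iff.2 ⟨by rw [hre]; simp, by rw [h]; simp⟩)
  · exact Or.inr (Complex.ext_iff.2 ⟨by rw [hre]; simp, by rw [h]; simp⟩)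

/-- Away from `ptA` and `ptB` the imaginary part does not vanish. [folklore] -/
theorem toC_im_ne_zero {u : 𝕊 1} (hA : u ≠ ptA) (hB : u ≠ ptB) : (toC (u : 𝔼 2)).im ≠ 0 := by
  intro h
  rcases toC_eq_or_of_im_eq_zero u h with h1 | h1
  · exact hA ((eq_ptA_iff u).2 h1)
  · exact hB ((eq_ptB_iff u).2 h1)

/-- `angA` takes values in `(0, 1]`. [folklore] -/
theorem angA_mem_Ioc (u : 𝕊 1) : angA u ∈ Ioc (0 : ℝ) 1 := by
  have h1 := neg_pi_lt_arg (-toC (u : 𝔼 2))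
  have h2 := arg_le_pi (-toC (u : 𝔼 2))
  have hπ := Real.pi_pos
  have hlo : -(1 / 2 : ℝ) < arg (-toC (u : 𝔼 2)) / (2 * π) := by
    rw [lt_div_iff₀ (by positivity)]; linarith
  have hhi : arg (-toC (u : 𝔼 2)) / (2 * π) ≤ 1 / 2 := by
    rw [div_le_iff₀ (by positivity)]; linarith
  exact ⟨by rw [angA]; linarith, by rw [angA]; linarith⟩

/-- `angB` takes values in `(1/2, 3/2]`. [folklore] -/
theorem angB_mem_Ioc (u : 𝕊 1) : angB u ∈ Ioc (1 / 2 : ℝ) (3 / 2) := by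
  have h1 := neg_pi_lt_arg (toC (u : 𝔼 2))
  have h2 := arg_le_pi (toC (u : 𝔼 2))
  have hπ := Real.pi_pos
  have hlo : -(1 / 2 : ℝ) < arg (toC (u : 𝔼 2)) / (2 * π) := by
    rw [lt_div_iff₀ (by positivity)]; linarith
  have hhi : arg (toC (u : 𝔼 2)) / (2 * π) ≤ 1 / 2 := by
    rw [div_le_iff₀ (by positivity)]; linarith
  exact ⟨by rw [angB]; linarith, by rw [angB]; linarith⟩

/-- Away from `ptA`, `angA < 1`. [folklore] -/
theorem angA_lt_one {u : 𝕊 1} (hu : u ≠ ptA) : angA u < 1 := by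
  have hπ := Real.pi_pos
  have hne : arg (-toC (u : 𝔼 2)) ≠ π := by
    intro h
    rw [arg_eq_pi_iff, neg_re, neg_im, neg_lt_zero, neg_eq_zero] at h
    rcases toC_eq_or_of_im_eq_zero u h.2 with h1 | h1
    · exact hu ((eq_ptA_iff u).2 h1)
    · rw [h1] at h; norm_num at h
  have hlt : arg (-toC (u : 𝔼 2)) < π := lt_of_le_of_ne (arg_le_pi _) hne
  have hhi : arg (-toC (u : 𝔼 2)) / (2 * π) < 1 / 2 := by
    rw [div_lt_iff₀ (by positivity)]; linarith
  rw [angA]; linarith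

/-- Away from `ptA`, `angA ∈ (0, 1)`. [folklore] -/
theorem angA_mem_Ioo {u : 𝕊 1} (hu : u ≠ ptA) : angA u ∈ Ioo (0 : ℝ) 1 :=
  ⟨(angA_mem_Ioc u).1, angA_lt_one hu⟩

/-- Away from `ptB`, `angB < 3/2`. [folklore] -/
theorem angB_lt {u : 𝕊 1} (hu : u ≠ ptB) : angB u < 3 / 2 := by
  have hπ := Real.pi_pos
  have hne : arg (toC (u : 𝔼 2)) ≠ π := by
    intro h
    rw [arg_eq_pi_iff] at h
    rcases toC_eq_or_of_im_eq_zero u h.2 with h1 | h1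
    · rw [h1] at h; norm_num at h
    · exact hu ((eq_ptB_iff u).2 h1)
  have hlt : arg (toC (u : 𝔼 2)) < π := lt_of_le_of_ne (arg_le_pi _) hne
  have hhi : arg (toC (u : 𝔼 2)) / (2 * π) < 1 / 2 := by
    rw [div_lt_iff₀ (by positivity)]; linarith
  rw [angB]; linarith

/-- Away from `ptB`, `angB ∈ (1/2, 3/2)`. [folklore] -/
theorem angB_mem_Ioo {u : 𝕊 1} (hu : u ≠ ptB) : angB u ∈ Ioo (1 / 2 : ℝ) (3 / 2) :=
  ⟨(angB_mem_Ioc u).1, angB_lt hu⟩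

/-- `circlePt ∘ angA = id`. [folklore] -/
@[simp] theorem circlePt_angA (u : 𝕊 1) : circlePt (angA u) = u := by
  have hπ := Real.pi_pos
  apply toCircle_injective
  apply Circle.ext
  rw [toCircle_circlePt, Circle.coe_exp, coe_toCircle]
  have h1 : 2 * π * angA u = π + arg (-toC (u : 𝔼 2)) := by
    rw [angA]; field_simp; try ring
  have h := norm_mul_exp_arg_mul_I (-toC (u : 𝔼 2))
  rw [norm_neg, norm_toC_sphere, ofReal_one, one_mul] at h
  rw [h1]
  push_cast
  rw [add_mul, Complex.exp_add, h, exp_pi_mul_I]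
  ring

/-- `circlePt ∘ angB = id`. [folklore] -/
@[simp] theorem circlePt_angB (u : 𝕊 1) : circlePt (angB u) = u := by
  have hπ := Real.pi_pos
  apply toCircle_injective
  apply Circle.ext
  rw [toCircle_circlePt, Circle.coe_exp, coe_toCircle]
  have h1 : 2 * π * angB u = 2 * π + arg (toC (u : 𝔼 2)) := by
    rw [angB]; field_simp; try ring
  have h := norm_mul_exp_arg_mul_I (toC (u : 𝔼 2))
  rw [norm_toC_sphere, ofReal_one, one_mul] at h
  rw [h1]
  push_cast
  rw [add_mul, Complex.exp_add, h, exp_two_pi_mul_I, one_mul]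

/-- `angA ∘ circlePt = id` on `(0, 1)`. [folklore] -/
theorem angA_circlePt {θ : ℝ} (hθ : θ ∈ Ioo (0 : ℝ) 1) : angA (circlePt θ) = θ := by
  have hπ := Real.pi_pos
  rw [angA, toC_circlePt]
  have : -(Circle.exp (2 * π * θ) : ℂ) = Circle.exp (2 * π * θ - π) := by
    rw [Circle.coe_exp, Circle.coe_exp]
    push_cast
    rw [sub_mul, Complex.exp_sub, exp_pi_mul_I]
    ring
  rw [this, Circle.arg_exp (by nlinarith [hθ.1]) (by nlinarith [hθ.2])]
  field_simp
  ring

/-- `angB ∘ circlePt = id` on `(1/2, 3/2)`. [folklore] -/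
theorem angB_circlePt {θ : ℝ} (hθ : θ ∈ Ioo (1 / 2 : ℝ) (3 / 2)) : angB (circlePt θ) = θ := by
  have hπ := Real.pi_pos
  rw [angB, toC_circlePt, ← Circle.exp_sub_two_pi,
    show 2 * π * θ - 2 * π = 2 * π * (θ - 1) by ring,
    Circle.arg_exp (by nlinarith [hθ.1]) (by nlinarith [hθ.2])]
  field_simp
  ring

/-- **Transition between the two angle functions.** Away from `ptA` and `ptB` either
`angA u < 1/2` and `angB u = angA u + 1` (upper half circle) or `1/2 < angA u` and
`angB u = angA u` (lower half circle). [folklore] -/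
theorem angB_eq_of_ne {u : 𝕊 1} (hA : u ≠ ptA) (hB : u ≠ ptB) :
    (angA u < 1 / 2 ∧ angB u = angA u + 1) ∨ (1 / 2 < angA u ∧ angB u = angA u) := by
  have hπ := Real.pi_pos
  have him := toC_im_ne_zero hA hB
  rcases him.lt_or_gt with hlt | hgt
  · right
    have h1 : arg (-toC (u : 𝔼 2)) = arg (toC (u : 𝔼 2)) + π := arg_neg_eq_arg_add_pi_of_im_neg hlt
    have h3 : -π < arg (toC (u : 𝔼 2)) := neg_pi_lt_arg _
    refine ⟨?_, ?_⟩
    · have : 0 < (arg (toC (u : 𝔼 2)) + π) / (2 * π) := div_pos (by linarith) (by positivity)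
      rw [angA, h1]; linarith
    · rw [angA, angB, h1]; field_simp; ring
  · left
    have h1 : arg (-toC (u : 𝔼 2)) = arg (toC (u : 𝔼 2)) - π := arg_neg_eq_arg_sub_pi_of_im_pos hgt
    have h2 : arg (toC (u : 𝔼 2)) ≤ π := arg_le_pi _
    have h3 : arg (toC (u : 𝔼 2)) ≠ π := fun h ↦ him (arg_eq_pi_iff.1 h).2
    refine ⟨?_, ?_⟩
    · have h4 : arg (toC (u : 𝔼 2)) - π < 0 := by
        have := lt_of_le_of_ne h2 h3; linarith
      have : (arg (toC (u : 𝔼 2)) - π) / (2 * π) < 0 := div_neg_of_neg_of_pos h4 (by positivity)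
      rw [angA, h1]; linarith
    · rw [angA, angB, h1]; field_simp; ring

/-- The map `u ↦ -toC u : 𝕊¹ → ℂ` is smooth. [folklore] -/
theorem contMDiff_neg_toC : ContMDiff (𝓡 1) 𝓘(ℝ, ℂ) ∞ fun u : 𝕊 1 ↦ -toC (u : 𝔼 2) :=
  haveI := Fact.mk (@finrank_euclideanSpace_fin ℝ _ 2)
  contDiff_toC.neg.comp_contMDiff contMDiff_coe_sphere

/-- The map `u ↦ toC u : 𝕊¹ → ℂ` is smooth. [folklore] -/
theorem contMDiff_toC : ContMDiff (𝓡 1) 𝓘(ℝ, ℂ) ∞ fun u : 𝕊 1 ↦ toC (u : 𝔼 2) :=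
  haveI := Fact.mk (@finrank_euclideanSpace_fin ℝ _ 2)
  contDiff_toC.comp_contMDiff contMDiff_coe_sphere

/-- **`angA` is smooth away from `ptA`.** [folklore] -/
theorem contMDiffAt_angA {u : 𝕊 1} (hu : u ≠ ptA) : ContMDiffAt (𝓡 1) 𝓘(ℝ, ℝ) ∞ angA u := by
  have hslit : -toC (u : 𝔼 2) ∈ slitPlane := by
    refine mem_slitPlane_of_norm_eq_one (by rw [norm_neg, norm_toC_sphere]) fun h ↦ hu ?_
    rw [eq_ptA_iff]; simpa using h
  have hg : ContDiffAt ℝ ∞ (fun z : ℂ ↦ 1 / 2 + arg z / (2 * π)) (-toC (u : 𝔼 2)) :=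
    contDiffAt_const.add ((contDiffAt_arg hslit).div_const _)
  exact hg.comp_contMDiffAt (f := fun u : 𝕊 1 ↦ -toC (u : 𝔼 2)) contMDiff_neg_toC.contMDiffAt

/-- **`angB` is smooth away from `ptB`.** [folklore] -/
theorem contMDiffAt_angB {u : 𝕊 1} (hu : u ≠ ptB) : ContMDiffAt (𝓡 1) 𝓘(ℝ, ℝ) ∞ angB u := by
  have hslit : toC (u : 𝔼 2) ∈ slitPlane := by
    refine mem_slitPlane_of_norm_eq_one (norm_toC_sphere u) fun h ↦ hu ?_
    rw [eq_ptB_iff]; exact h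
  have hg : ContDiffAt ℝ ∞ (fun z : ℂ ↦ 1 + arg z / (2 * π)) (toC (u : 𝔼 2)) :=
    contDiffAt_const.add ((contDiffAt_arg hslit).div_const _)
  exact hg.comp_contMDiffAt (f := fun u : 𝕊 1 ↦ toC (u : 𝔼 2)) contMDiff_toC.contMDiffAt

/-- `ptA ≠ ptB`. [folklore] -/
theorem ptA_ne_ptB : ptA ≠ ptB := by
  intro h
  have := congrArg (fun u : 𝕊 1 ↦ toC (u : 𝔼 2)) h
  simp only [toC_ptA, toC_ptB] at this
  norm_num at this

end CircleAngle

end Literature.Topology.FourManifolds
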